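import Literature.AlgebraicGeometry.FundamentalGroup.HypersurfaceComplementPencilDiscriminantHomogeneous
import Literature.AlgebraicGeometry.FundamentalGroup.HypersurfaceComplementPencilDiscriminantShift
import HarnessLib

/-!
# The pencil discriminant at a FIXED base point: the half-specialised restriction `h(b + X v) ∈ ℂ[v][X]`
# and «squarefree ⇒ a transversal line through `b`» (Dimca Ch. 4 Prop. (3.1), the pointed form)

Family `hodge`, layer `Literature/AlgebraicGeometry/FundamentalGroup`; two small definitions (`baseSpz`,
`halfLinePoly`) and proved bookkeeping, no named fact.  Written by the prover seat `hodge-nonav-prover-Ax` (g15,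
cell `hodge-nonav`), programme «FIXED-BASE BERTINI» serving the pencil readings (a″) of routes
`CyclicUnitaryPowers` ∕ `SignSymmetricPowers` of the Hodge summit (`…GenericPencilsHodgeOffCountable`,
`SignSymmetricPowersGeneralPencil`): their Zariski-open condition `pencilDiscr h (b, v) ≠ 0` on the pointed line
`(b, v)` is shown to be satisfiable for EVERY base point `b ∉ V(h)` as soon as the half-specialised restriction is
squarefree («through every point off the hypersurface passes a line meeting it transversally in `deg h` points»).

* §1 `baseSpz b : ℂ[b', v] →ₐ ℂ[v]` (`b' ↦ b`, `v ↦ v`) and **`halfLinePoly h b = h(b + X v) ∈ ℂ[v][X]`**, the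
  restriction `lineRestr₂ h` with the base point specialised and the direction kept generic; its specialisations
  are the restrictions `linePoly h b v` (`map_eval_halfLinePoly`); constant term `h(b)`, `X`-degree `deg h`, leading
  coefficient the top homogeneous component `h_D` (`coeff_halfLinePoly_totalDegree`, `natDegree_halfLinePoly`);
  also `natDegree_lineRestr₂ : deg_X h(b' + X v) = deg h`.
* §2 Gauss: if `halfLinePoly h b` is squarefree it is squarefree, hence SEPARABLE, over the fraction field `ℂ(v)`
  (`squarefree_map_fractionRing`, `separable_map_halfLinePoly`).
* §3 **`exists_eval_pencilDiscr_ne_zero_of_squarefree_halfLinePoly`**: clearing denominators in a Bézout identity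
  over `ℂ(v)` and specialising the direction off one non-zero polynomial gives `v` with `linePoly h b v` separable of
  full degree, i.e. `pencilDiscr h (b, v) ≠ 0` (`eval_pencilDiscr_ne_zero`).

Sequel (`…FixedBaseSquarefree`): `Squarefree h ⇒ Squarefree (halfLinePoly h b)` for `h(b) ≠ 0`.

## References
* [Dimca1992] A. Dimca, *Singularities and Topology of Hypersurfaces* (1992), Ch. 4 §3 Prop. (3.1) and the remark
  after it (generic lines through a point).
* [Shafarevich1994] I. R. Shafarevich, *Basic Algebraic Geometry 1* (1994), Book 1 I §3.1 (resultants), II §6.4.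
-/

noncomputable section

open MvPolynomial Polynomial

namespace Literature.AlgebraicGeometry.FundamentalGroup

variable {ι : Type}

/-! ### §1 The half-specialised restriction -/

section Half

/-- **Specialising the base point**: `b'_k ↦ b_k`, `v_k ↦ v_k` — from the two-parameter coefficient ring `ℂ[b', v]`
of `lineRestr₂` to the ring `ℂ[v]` of directions. [cite: Dimca1992, Ch. 4 §3 Prop. (3.1)] -/
def baseSpz (b : ι → ℂ) : MvPolynomial (ι ⊕ ι) ℂ →ₐ[ℂ] MvPolynomial ι ℂ :=
  MvPolynomial.aeval (Sum.elim (fun k => MvPolynomial.C (b k)) MvPolynomial.X)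

/-- `baseSpz` on a base-point variable. [cite: Dimca1992, Ch. 4 §3 Prop. (3.1)] -/
@[simp] theorem baseSpz_X_inl (b : ι → ℂ) (k : ι) : baseSpz b (X (Sum.inl k)) = MvPolynomial.C (b k) := by
  rw [baseSpz, MvPolynomial.aeval_X, Sum.elim_inl]

/-- `baseSpz` on a direction variable. [cite: Dimca1992, Ch. 4 §3 Prop. (3.1)] -/
@[simp] theorem baseSpz_X_inr (b : ι → ℂ) (k : ι) : baseSpz b (X (Sum.inr k)) = X k := by
  rw [baseSpz, MvPolynomial.aeval_X, Sum.elim_inr]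

/-- Evaluating the direction after specialising the base point is evaluating at `(b, v)`.
[cite: Dimca1992, Ch. 4 §3 Prop. (3.1)] -/
theorem eval_comp_baseSpz (b v : ι → ℂ) :
    (MvPolynomial.eval v).comp (baseSpz b).toRingHom = MvPolynomial.eval (Sum.elim b v) := by
  refine MvPolynomial.ringHom_ext (fun a => ?_) fun k => ?_
  · rw [RingHom.comp_apply, AlgHom.toRingHom_eq_coe, AlgHom.coe_toRingHom, MvPolynomial.algHom_C, MvPolynomial.algebraMap_eq,
      MvPolynomial.eval_C, MvPolynomial.eval_C]
  · rcases k with k | k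
    · rw [RingHom.comp_apply, AlgHom.toRingHom_eq_coe, AlgHom.coe_toRingHom, baseSpz_X_inl, MvPolynomial.eval_C,
        MvPolynomial.eval_X, Sum.elim_inl]
    · rw [RingHom.comp_apply, AlgHom.toRingHom_eq_coe, AlgHom.coe_toRingHom, baseSpz_X_inr, MvPolynomial.eval_X,
        MvPolynomial.eval_X, Sum.elim_inr]

/-- **The half-specialised restriction `h(b + X v) ∈ ℂ[v][X]`**: base point numeric, direction generic.
[cite: Dimca1992, Ch. 4 §3 Prop. (3.1)] -/
def halfLinePoly (h : MvPolynomial ι ℂ) (b : ι → ℂ) : (MvPolynomial ι ℂ)[X] :=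
  (lineRestr₂ h).map (baseSpz b).toRingHom

/-- Specialising the direction gives the restriction to the pointed line `(b, v)`.
[cite: Dimca1992, Ch. 4 §3 Prop. (3.1)] -/
theorem map_eval_halfLinePoly (h : MvPolynomial ι ℂ) (b v : ι → ℂ) :
    (halfLinePoly h b).map (MvPolynomial.eval v) = linePoly h b v := by
  rw [halfLinePoly, linePoly, Polynomial.map_map, eval_comp_baseSpz]

/-- Coefficientwise: `(coeff_j h(b + Xv))(v) = coeff_j (linePoly h b v)`. [cite: Dimca1992, Ch. 4 §3 Prop. (3.1)] -/
theorem eval_coeff_halfLinePoly (h : MvPolynomial ι ℂ) (b v : ι → ℂ) (j : ℕ) :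
    MvPolynomial.eval v ((halfLinePoly h b).coeff j) = (linePoly h b v).coeff j := by
  rw [← map_eval_halfLinePoly, Polynomial.coeff_map]

/-- `linePoly` is additive in the polynomial. [cite: Dimca1992, Ch. 4 §3 Prop. (3.1)] -/
theorem linePoly_add (f g : MvPolynomial ι ℂ) (b v : ι → ℂ) :
    linePoly (f + g) b v = linePoly f b v + linePoly g b v := by
  rw [linePoly, linePoly, linePoly, map_add, Polynomial.map_add]

/-- `linePoly` of a finite sum. [cite: Dimca1992, Ch. 4 §3 Prop. (3.1)] -/
theorem linePoly_sum {α : Type*} (s : Finset α) (f : α → MvPolynomial ι ℂ) (b v : ι → ℂ) :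
    linePoly (∑ a ∈ s, f a) b v = ∑ a ∈ s, linePoly (f a) b v := by
  rw [linePoly, map_sum, Polynomial.map_sum]
  rfl

/-- **The coefficients of the restriction beyond and at the total degree**: for `j ≥ D = deg h`,
`coeff_j (linePoly h b v)` is `h_D(v)` if `j = D` and `0` if `j > D` (decompose `h` into homogeneous components;
the component of degree `i` restricts to a polynomial of degree `≤ i` with `X^i`-coefficient `h_i(v)`).
[cite: Dimca1992, Ch. 4 §3, remark after Prop. (3.1) (`d` intersection points)] -/
theorem coeff_linePoly_of_totalDegree_le (h : MvPolynomial ι ℂ) (b v : ι → ℂ) {j : ℕ} (hj : h.totalDegree ≤ j) :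
    (linePoly h b v).coeff j = if j = h.totalDegree then MvPolynomial.eval v (homogeneousComponent h.totalDegree h) else 0 := by
  classical
  conv_lhs => rw [← sum_homogeneousComponent h]
  rw [linePoly_sum, Polynomial.finsetSum_coeff]
  have hterm : ∀ i ∈ Finset.range (h.totalDegree + 1), (linePoly (homogeneousComponent i h) b v).coeff j =
      if i = j then MvPolynomial.eval v (homogeneousComponent j h) else 0 := by
    intro i hi
    by_cases hij : i = j
    · subst hij
      rw [if_pos rfl, coeff_linePoly_of_isHomogeneous (homogeneousComponent_isHomogeneous i h)]
    · rw [if_neg hij]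
      have hlt : i < j := lt_of_le_of_ne (by have := Finset.mem_range.1 hi; omega) hij
      exact Polynomial.coeff_eq_zero_of_natDegree_lt
        (lt_of_le_of_lt (natDegree_linePoly_le_of_isHomogeneous (homogeneousComponent_isHomogeneous i h) b v) hlt)
  rw [Finset.sum_congr rfl hterm, Finset.sum_ite_eq' (Finset.range (h.totalDegree + 1)) j]
  by_cases hjD : j = h.totalDegree
  · subst hjD
    rw [if_pos (Finset.mem_range.2 (Nat.lt_succ_self _)), if_pos rfl]
  · rw [if_neg (fun hm => hjD (le_antisymm (Nat.lt_succ_iff.1 (Finset.mem_range.1 hm)) hj)), if_neg hjD]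

/-- The top homogeneous component of a non-zero polynomial is non-zero. [folklore] -/
private theorem homogeneousComponent_totalDegree_ne_zero {σ : Type*} {h : MvPolynomial σ ℂ} (hh : h ≠ 0) :
    homogeneousComponent h.totalDegree h ≠ 0 := by
  classical
  obtain ⟨m, hm, hmdeg⟩ : ∃ m ∈ h.support, h.totalDegree = m.sum fun _ e => e :=
    Finset.exists_mem_eq_sup h.support (MvPolynomial.support_nonempty.mpr hh) _
  intro h0
  have hc := congrArg (MvPolynomial.coeff m) h0
  rw [coeff_homogeneousComponent, if_pos, MvPolynomial.coeff_zero] at hc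
  · exact (MvPolynomial.mem_support_iff.mp hm) hc
  · rw [Finsupp.degree_apply, hmdeg]
    rfl

/-- **`deg_X h(b' + X v) = deg h`** for `h ≠ 0` (the `X^D`-coefficient is the top component `h_D(v)`).
[cite: Dimca1992, Ch. 4 §3, remark after Prop. (3.1)] -/
theorem natDegree_lineRestr₂ {h : MvPolynomial ι ℂ} (hh : h ≠ 0) : (lineRestr₂ h).natDegree = h.totalDegree := by
  classical
  apply le_antisymm
  · conv_lhs => rw [← sum_homogeneousComponent h]
    rw [map_sum]
    refine Polynomial.natDegree_sum_le_of_forall_le _ _ fun i hi => ?_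
    by_cases h0 : homogeneousComponent i h = 0
    · rw [h0, map_zero, Polynomial.natDegree_zero]; exact Nat.zero_le _
    · rw [natDegree_lineRestr₂_of_isHomogeneous (homogeneousComponent_isHomogeneous i h) h0]
      exact Nat.lt_succ_iff.1 (Finset.mem_range.1 hi)
  · -- some `(b, v)` with `h_D(v) ≠ 0`: the `X^D`-coefficient does not vanish there
    obtain ⟨v, hv⟩ : ∃ v : ι → ℂ, MvPolynomial.eval v (homogeneousComponent h.totalDegree h) ≠ 0 := by
      by_contra hc; push Not at hc
      exact homogeneousComponent_totalDegree_ne_zero hh (MvPolynomial.funext fun x => by rw [hc x, map_zero])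
    refine Polynomial.le_natDegree_of_ne_zero fun h0 => hv ?_
    have h1 := coeff_linePoly_of_totalDegree_le h v v le_rfl
    rw [if_pos rfl, linePoly, Polynomial.coeff_map, h0, map_zero] at h1
    exact h1.symm

variable (h : MvPolynomial ι ℂ) (b : ι → ℂ)

/-- **Constant term**: `coeff_0 h(b + Xv) = h(b)` (a constant of `ℂ[v]`). [cite: Dimca1992, Ch. 4 §3 Prop. (3.1)] -/
theorem coeff_zero_halfLinePoly : (halfLinePoly h b).coeff 0 = MvPolynomial.C (MvPolynomial.eval b h) := by
  refine MvPolynomial.funext fun v => ?_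
  rw [eval_coeff_halfLinePoly, MvPolynomial.eval_C, Polynomial.coeff_zero_eq_eval_zero, eval_linePoly, zero_smul, add_zero]

/-- **Top coefficient**: `coeff_D h(b + Xv) = h_D(v)`, the top homogeneous component, and the higher coefficients vanish.
[cite: Dimca1992, Ch. 4 §3, remark after Prop. (3.1)] -/
theorem coeff_halfLinePoly_of_totalDegree_le {j : ℕ} (hj : h.totalDegree ≤ j) :
    (halfLinePoly h b).coeff j = if j = h.totalDegree then homogeneousComponent h.totalDegree h else 0 := by
  refine MvPolynomial.funext fun v => ?_
  rw [eval_coeff_halfLinePoly, coeff_linePoly_of_totalDegree_le h b v hj]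
  split_ifs with hjD
  · rfl
  · rw [map_zero]

/-- `deg_X h(b + Xv) = deg h` for `h ≠ 0`. [cite: Dimca1992, Ch. 4 §3, remark after Prop. (3.1)] -/
theorem natDegree_halfLinePoly (hh : h ≠ 0) : (halfLinePoly h b).natDegree = h.totalDegree := by
  apply le_antisymm
  · rw [Polynomial.natDegree_le_iff_coeff_eq_zero]
    intro N hN
    rw [coeff_halfLinePoly_of_totalDegree_le h b hN.le, if_neg (Nat.ne_of_gt hN)]
  · refine Polynomial.le_natDegree_of_ne_zero ?_
    rw [coeff_halfLinePoly_of_totalDegree_le h b le_rfl, if_pos rfl]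
    exact homogeneousComponent_totalDegree_ne_zero hh

/-- The leading coefficient of `h(b + Xv)` is the top component `h_D`. [cite: Dimca1992, Ch. 4 §3, remark after Prop. (3.1)] -/
theorem leadingCoeff_halfLinePoly (hh : h ≠ 0) :
    (halfLinePoly h b).leadingCoeff = homogeneousComponent h.totalDegree h := by
  rw [Polynomial.leadingCoeff, natDegree_halfLinePoly h b hh, coeff_halfLinePoly_of_totalDegree_le h b le_rfl, if_pos rfl]

/-- **The half-specialised restriction is primitive when `h(b) ≠ 0`** (its constant term is a unit).
[cite: Shafarevich1994, Book 1 I §3.1] -/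
theorem isPrimitive_halfLinePoly (hb : MvPolynomial.eval b h ≠ 0) : (halfLinePoly h b).IsPrimitive := by
  intro r hr
  have h0 := (Polynomial.C_dvd_iff_dvd_coeff r _).1 hr 0
  rw [coeff_zero_halfLinePoly] at h0
  exact isUnit_of_dvd_unit h0 ((MvPolynomial.isUnit_iff_eq_C_of_isReduced).2 ⟨_, isUnit_iff_ne_zero.2 hb, rfl⟩)

/-- The leading-coefficient factor of the pencil discriminant at `(b, v)` is `h_D(v)` (`h ≠ 0`).
[cite: Dimca1992, Ch. 4 §3 Prop. (3.1)] -/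
theorem eval_leadingCoeff_lineRestr₂_eq (hh : h ≠ 0) (v : ι → ℂ) :
    MvPolynomial.eval (Sum.elim b v) (lineRestr₂ h).leadingCoeff =
      MvPolynomial.eval v (homogeneousComponent h.totalDegree h) := by
  rw [eval_leadingCoeff_lineRestr₂, natDegree_lineRestr₂ hh, coeff_linePoly_of_totalDegree_le h b v le_rfl, if_pos rfl]

end Half

/-! ### §2 Gauss: squarefree over `ℂ[v]` ⇒ separable over `ℂ(v)` -/

section Gauss

variable {A : Type*} [CommRing A] [IsDomain A] [UniqueFactorizationMonoid A] {K : Type*} [Field K] [Algebra A K]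
  [IsFractionRing A K]

/-- **Gauss**: a squarefree polynomial over a UFD stays squarefree over the fraction field (a square factor over
`K` has a PRIMITIVE representative, whose square then divides over `A`). [cite: Shafarevich1994, Book 1 I §3.1] -/
theorem squarefree_map_fractionRing {P : A[X]} (hP : Squarefree P) :
    Squarefree (P.map (algebraMap A K)) := by
  classical
  letI : NormalizedGCDMonoid A := Nonempty.some inferInstance
  intro x hx
  by_contra hxu
  have hP0 : P ≠ 0 := hP.ne_zero
  have hPK0 : P.map (algebraMap A K) ≠ 0 := fun h0 =>
    hP0 (Polynomial.map_injective _ (IsFractionRing.injective A K) (by rw [h0, Polynomial.map_zero]))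
  have hx0 : x ≠ 0 := fun h0 => hPK0 (by obtain ⟨r, hr⟩ := hx; rw [hr, h0, zero_mul, zero_mul])
  -- an integral, primitive representative `q` of the line `K·x`
  obtain ⟨c, hcM, hc⟩ := IsLocalization.integerNormalization_spec (nonZeroDivisors A) x
  set y := IsLocalization.integerNormalization (nonZeroDivisors A) x with hy
  have hc0 : (c : A) ≠ 0 := nonZeroDivisors.ne_zero hcM
  have hy0 : y ≠ 0 := by
    intro h0
    have : (c : A) • x = 0 := by rw [← hc, h0, Polynomial.map_zero]
    rw [smul_eq_zero] at this
    exact this.elim hc0 hx0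
  set q := y.primPart with hq
  have hqprim : q.IsPrimitive := Polynomial.isPrimitive_primPart y
  -- `q_K` is a `K`-unit multiple of `x`
  have hyq : y = Polynomial.C y.content * q := Polynomial.eq_C_content_mul_primPart y
  have hcont0 : y.content ≠ 0 := fun h0 => hy0 (Polynomial.content_eq_zero_iff.1 h0)
  have hqK : q.map (algebraMap A K) = Polynomial.C ((algebraMap A K y.content)⁻¹ * algebraMap A K c) * x := by
    have h1 : (Polynomial.C y.content * q).map (algebraMap A K) = (c : A) • x := by rw [← hyq, hc]
    rw [Polynomial.map_mul, Polynomial.map_C] at h1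
    have hu : algebraMap A K y.content ≠ 0 := fun h0 =>
      hcont0 (IsFractionRing.injective A K (by rw [h0, map_zero]))
    calc q.map (algebraMap A K)
        = Polynomial.C ((algebraMap A K y.content)⁻¹) * (Polynomial.C (algebraMap A K y.content) * q.map (algebraMap A K)) := by
          rw [← mul_assoc, ← Polynomial.C_mul, inv_mul_cancel₀ hu, Polynomial.C_1, one_mul]
      _ = Polynomial.C ((algebraMap A K y.content)⁻¹) * ((c : A) • x) := by rw [h1]
      _ = Polynomial.C ((algebraMap A K y.content)⁻¹ * algebraMap A K c) * x := by
          rw [Polynomial.C_mul, mul_assoc, Algebra.smul_def, Polynomial.algebraMap_apply]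
  -- hence `q_K² ∣ P_K`, and by Gauss `q² ∣ P`
  set u : K := (algebraMap A K y.content)⁻¹ * algebraMap A K c with hu
  have hu0 : u ≠ 0 := by
    refine mul_ne_zero (inv_ne_zero ?_) ?_
    · exact fun h0 => hcont0 (IsFractionRing.injective A K (by rw [h0, map_zero]))
    · exact fun h0 => hc0 (IsFractionRing.injective A K (by rw [h0, map_zero]))
  have hxq : x = Polynomial.C u⁻¹ * q.map (algebraMap A K) := by
    rw [hqK, ← mul_assoc, ← Polynomial.C_mul, inv_mul_cancel₀ hu0, Polynomial.C_1, one_mul]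
  have hdvdK : (q * q).map (algebraMap A K) ∣ P.map (algebraMap A K) := by
    obtain ⟨r, hr⟩ := hx
    rw [hxq] at hr
    refine ⟨Polynomial.C u⁻¹ * Polynomial.C u⁻¹ * r, ?_⟩
    rw [Polynomial.map_mul, hr]
    ring
  have hdvd : q * q ∣ P := (hqprim.mul hqprim).dvd_of_fraction_map_dvd_fraction_map hdvdK
  -- so `q` is a unit of `A[X]`, i.e. a unit constant, and `x` is a unit of `K[X]`
  obtain ⟨w, hw, hwq⟩ := Polynomial.isUnit_iff.1 (hP q hdvd)
  apply hxu
  rw [hxq, ← hwq, Polynomial.map_C, ← Polynomial.C_mul]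
  exact Polynomial.isUnit_C.2 ((isUnit_iff_ne_zero.2 (inv_ne_zero hu0)).mul (hw.map (algebraMap A K)))

end Gauss

section Separable

variable {ι : Type} (h : MvPolynomial ι ℂ) (b : ι → ℂ)

/-- **The half-specialised restriction is separable over `ℂ(v)`** when it is squarefree (Gauss + perfect field).
[cite: Shafarevich1994, Book 1 I §3.1] [cite: Dimca1992, Ch. 4 §3 Prop. (3.1)] -/
theorem separable_map_halfLinePoly (hsq : Squarefree (halfLinePoly h b)) :
    ((halfLinePoly h b).map (algebraMap (MvPolynomial ι ℂ) (FractionRing (MvPolynomial ι ℂ)))).Separable := by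
  haveI : CharZero (FractionRing (MvPolynomial ι ℂ)) :=
    charZero_of_injective_algebraMap (IsFractionRing.injective (MvPolynomial ι ℂ) (FractionRing (MvPolynomial ι ℂ)))
  exact PerfectField.separable_iff_squarefree.2 (squarefree_map_fractionRing hsq)

/-! ### §3 A transversal line through every point off `V(h)` -/

/-- A non-zero complex polynomial in several variables takes a non-zero value. [cite: Shafarevich1994, Book 1 I §3.1] -/
theorem exists_eval_ne_zero_of_ne_zero {σ : Type} {p : MvPolynomial σ ℂ} (hp : p ≠ 0) :
    ∃ x : σ → ℂ, MvPolynomial.eval x p ≠ 0 := by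
  by_contra hc; push Not at hc
  exact hp (MvPolynomial.funext fun x => by rw [hc x, map_zero])

/-- **Through every point off a hypersurface passes a transversal line, provided the half-specialised restriction
is squarefree**: if `h(b) ≠ 0` and `h(b + Xv) ∈ ℂ[v][X]` is squarefree, then `pencilDiscr h (b, v) ≠ 0` for some
direction `v` — clear denominators in a Bézout identity over `ℂ(v)` and specialise `v` off one non-zero polynomial.
[cite: Dimca1992, Ch. 4 §3 Prop. (3.1) and the remark after it] [cite: Shafarevich1994, Book 1 I §3.1] -/
theorem exists_eval_pencilDiscr_ne_zero_of_squarefree_halfLinePoly [Fintype ι] (hsq : Squarefree (halfLinePoly h b))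
    (hb : MvPolynomial.eval b h ≠ 0) : ∃ v : ι → ℂ, MvPolynomial.eval (Sum.elim b v) (pencilDiscr h) ≠ 0 := by
  classical
  have hh : h ≠ 0 := fun h0 => hb (by rw [h0, map_zero])
  have hinj : Function.Injective (algebraMap (MvPolynomial ι ℂ) (FractionRing (MvPolynomial ι ℂ))) :=
    IsFractionRing.injective (MvPolynomial ι ℂ) (FractionRing (MvPolynomial ι ℂ))
  -- Bézout over `K = ℂ(v)`, denominators cleared
  obtain ⟨a, c, habc⟩ := (Polynomial.separable_def' _).1 (separable_map_halfLinePoly h b hsq)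
  obtain ⟨da, hdaM, hda⟩ := IsLocalization.integerNormalization_spec (nonZeroDivisors (MvPolynomial ι ℂ)) a
  obtain ⟨dc, hdcM, hdc⟩ := IsLocalization.integerNormalization_spec (nonZeroDivisors (MvPolynomial ι ℂ)) c
  have hda0 : (da : MvPolynomial ι ℂ) ≠ 0 := nonZeroDivisors.ne_zero hdaM
  have hdc0 : (dc : MvPolynomial ι ℂ) ≠ 0 := nonZeroDivisors.ne_zero hdcM
  have hbez : Polynomial.C dc * IsLocalization.integerNormalization (nonZeroDivisors (MvPolynomial ι ℂ)) a * halfLinePoly h b +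
      Polynomial.C da * IsLocalization.integerNormalization (nonZeroDivisors (MvPolynomial ι ℂ)) c *
        Polynomial.derivative (halfLinePoly h b) = Polynomial.C (da * dc) := by
    apply Polynomial.map_injective _ hinj
    rw [Polynomial.map_add, Polynomial.map_mul, Polynomial.map_mul, Polynomial.map_mul, Polynomial.map_mul,
      Polynomial.map_C, Polynomial.map_C, Polynomial.map_C, hda, hdc, ← Polynomial.derivative_map, Algebra.smul_def,
      Algebra.smul_def, Polynomial.algebraMap_apply, Polynomial.algebraMap_apply, map_mul, Polynomial.C_mul]
    linear_combination (Polynomial.C (algebraMap (MvPolynomial ι ℂ) (FractionRing (MvPolynomial ι ℂ)) da) *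
      Polynomial.C (algebraMap (MvPolynomial ι ℂ) (FractionRing (MvPolynomial ι ℂ)) dc)) * habc
  -- a direction off the zeros of `da · dc · h_D`
  obtain ⟨v, hv⟩ := exists_eval_ne_zero_of_ne_zero
    (mul_ne_zero (mul_ne_zero hda0 hdc0) (homogeneousComponent_totalDegree_ne_zero hh))
  rw [map_mul, mul_ne_zero_iff] at hv
  obtain ⟨hv1, hv2⟩ := hv
  refine ⟨v, eval_pencilDiscr_ne_zero hb ?_ ?_⟩
  · rw [eval_leadingCoeff_lineRestr₂_eq h b hh]
    exact hv2
  · -- specialise the Bézout identity at `v`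
    rw [Polynomial.separable_def]
    have hmap := congrArg (Polynomial.map (MvPolynomial.eval v)) hbez
    rw [Polynomial.map_add, Polynomial.map_mul, Polynomial.map_mul, Polynomial.map_mul, Polynomial.map_mul,
      Polynomial.map_C, Polynomial.map_C, Polynomial.map_C, ← Polynomial.derivative_map, map_eval_halfLinePoly] at hmap
    have hk : Polynomial.C (MvPolynomial.eval v (da * dc))⁻¹ * Polynomial.C (MvPolynomial.eval v (da * dc)) = 1 := by
      rw [← Polynomial.C_mul, inv_mul_cancel₀ hv1, Polynomial.C_1]
    exact ⟨Polynomial.C (MvPolynomial.eval v (da * dc))⁻¹ * (Polynomial.C (MvPolynomial.eval v dc) *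
        (IsLocalization.integerNormalization (nonZeroDivisors (MvPolynomial ι ℂ)) a).map (MvPolynomial.eval v)),
      Polynomial.C (MvPolynomial.eval v (da * dc))⁻¹ * (Polynomial.C (MvPolynomial.eval v da) *
        (IsLocalization.integerNormalization (nonZeroDivisors (MvPolynomial ι ℂ)) c).map (MvPolynomial.eval v)),
      by linear_combination (Polynomial.C (MvPolynomial.eval v (da * dc))⁻¹) * hmap + hk⟩

end Separable

end Literature.AlgebraicGeometry.FundamentalGroup

end
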